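import Mathlib
import HarnessLib
import Summits.HubbardSuperconductivity.HubbardSuperconductivity.Theorems.KLProgrammeH10TwoPointLimitFrameFermiPoint

/-!
# Route `KLProgramme` — child `KLRegimeCounterterm` (gen 3): the frame's Fermi point `θ ↦ klFermiPoint μ K θ` and the frame read on its own
# curve `θ ↦ K(k_F(θ))` are LIPSCHITZ IN THE ANGLE, with constants explicit in the frame's `C²` size `A` and the band's radial
# transversality `Dt_min` (seat hubbard-kl-k3c3-p3; the frame half of `Λ_φ` in p1b's five-step route, cell STATUS 2026-08-26 l.994 / l.1093)

After Δ18 the one-volume construction reads the renormalisation condition at every angle from lattice-angle control, the angular modulus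
(E3g) of the local part, and the off-lattice wiggle bound `abs_eval_klFrameExtG_sub_le` (p1b), whose inputs at the frame's curve point
`q = klFermiPoint μ K θ` are the Lipschitz constant `Λ_φ` of `φ = K∘k_F − ν_N(K)` and `‖q‖ ≥ r`.  This module supplies the FRAME half,
for a frame `K : TrigPolyC4v` of `C²` size `A` (`‖Dʲ(frameShift K)‖ ≤ A`, `j ≤ 2`) on a band window `BandBounds a b` with
`[μ − A, μ + A] ⊂ [a, b]` and `2A < Dt_min` (p4's moving-curve hypotheses, `…H10TwoPointLimitFramePerturbation` / `…PerturbedFermiRadiusSmooth`):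

* §1 the frame's radius `u_K = perturbedFermiRadius (−K) μ` (p4's `…FrameFermiPoint`: root selection, `C^∞`,
  `|u_K′| ≤ (4 + 2A)·u_K/(Dt_min − 2A)`) satisfies `u_min ≤ u_K ≤ π√2`;
* §2 `klFermiPoint μ K` is differentiable with `‖k_F′(θ)‖ ≤ |u_K′(θ)| + u_K(θ)`, hence Lipschitz with constant
  `frameCurveLip A Dt := π√2·(1 + (4 + 2A)/(Dt − 2A))` (written out, no definition): `norm_klFermiPoint_sub_le`;
  and `‖momToComplex (k_F θ)‖ = u_K(θ) ≥ u_min` (`norm_momToComplex_klFermiPoint`);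
* §3 the frame on its curve: `|d/dθ K(k_F θ)| ≤ 2A·(|u_K′| + u_K)` and the Lipschitz bound `abs_frameOnCurve_sub_le`.

For ADMISSIBLE frames in the KL regime take `A = 2·Gfr 0·|U| + 2·Gfr 1·U² + Gfr 2·c/log 4`
(`norm_iteratedFDeriv_frameShift_le_of_frameOK_regime`, p4) and p4's `frame_thresholds`.  Proofs only; nothing is asserted about the model.
References: BGM 2006 [arXiv:cond-mat/0507686] §2.4 Lemma 2.1 (2.40); HOME/hubbard-kl-k3c3-p3/DEFECT-ANGULAR.md §5.
-/

noncomputable section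

namespace Summit.HubbardSuperconductivity.HubbardSuperconductivity.Theorems.KLRegimeSplit

set_option linter.dupNamespace false -- summit = problem name (single-conjunct summit), D-0017

open Real Set Complex
open Literature.MathematicalPhysics.QuantumLattice Literature.MathematicalPhysics.QuantumLattice.BandSectorCounting
open Summit.HubbardSuperconductivity.HubbardSuperconductivity.Theorems.DispersionFlow
open Summit.HubbardSuperconductivity.HubbardSuperconductivity.Theorems.PerturbedFermiCurve

section Frame

variable {a b : ℝ} (B : BandBounds a b) {K : TrigPolyC4v} {A : ℝ}
  (hA : ∀ p : Momentum, ∀ j ≤ 2, ‖iteratedFDeriv ℝ j (frameShift K) p‖ ≤ A) {μ : ℝ} (hlo : a ≤ μ - A) (hhi : μ + A ≤ b)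
  (hDt : 2 * A < B.Dtmin)

/-! ## §1 The frame's radius: size bounds -/

include hA in
/-- `|δ_K| ≤ A` in the radius' own spelling `δ_K = (p ↦ −K(p))`. -/
theorem abs_neg_eval_le_of_frameSize (k : Fin 2 → ℝ) (_hk : ∀ i, |k i| ≤ π) : |(fun p : Fin 2 → ℝ => -K.eval p) k| ≤ A := by
  simpa [frameShift_toLp] using abs_frameShift_toLp_le hA k

omit hDt in
include B hA hlo hhi in
/-- `u_min ≤ u_K(θ)`. -/
theorem umin_le_frameRadius (θ : ℝ) : B.umin ≤ perturbedFermiRadius (fun p : Fin 2 → ℝ => -K.eval p) μ θ :=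
  umin_le_perturbedFermiRadius B (by rw [← frameShift_toLp_eq_neg_eval]; exact continuous_frameShift_toLp K)
    (abs_neg_eval_le_of_frameSize hA) hlo hhi θ

omit hDt in
include B hA hlo hhi in
/-- `0 < u_K(θ)`. -/
theorem frameRadius_pos (θ : ℝ) : 0 < perturbedFermiRadius (fun p : Fin 2 → ℝ => -K.eval p) μ θ :=
  (perturbedFermiRadius_mem_Ioo B (by rw [← frameShift_toLp_eq_neg_eval]; exact continuous_frameShift_toLp K)
    (abs_neg_eval_le_of_frameSize hA) hlo hhi θ).1

omit hDt in
include B hA hlo hhi in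
/-- `u_K(θ) ≤ π√2` (the curve lies in the open square). -/
theorem frameRadius_le (θ : ℝ) : perturbedFermiRadius (fun p : Fin 2 → ℝ => -K.eval p) μ θ ≤ π * Real.sqrt 2 := by
  have h := (perturbedFermiRadius_mem_Ioo B (by rw [← frameShift_toLp_eq_neg_eval]; exact continuous_frameShift_toLp K)
    (abs_neg_eval_le_of_frameSize hA) hlo hhi θ).2
  have hd := sqrt_two_div_two_le_norm_dir θ
  have hs : (0 : ℝ) < Real.sqrt 2 := Real.sqrt_pos.2 (by norm_num)
  have hs2 : Real.sqrt 2 * Real.sqrt 2 = 2 := Real.mul_self_sqrt (by norm_num)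
  have hdpos : 0 < ‖dir θ‖ := norm_dir_pos θ
  have : π / ‖dir θ‖ ≤ π * Real.sqrt 2 := by
    rw [div_le_iff₀ hdpos]
    have : π * 1 ≤ π * (Real.sqrt 2 * ‖dir θ‖) := by
      apply mul_le_mul_of_nonneg_left _ pi_pos.le
      nlinarith
    linarith
  exact h.le.trans this

include B hA hlo hhi hDt in
/-- The frame's radius is differentiable in the angle (p4's `contDiff_klFermiRadius`). -/
theorem differentiable_frameRadius : Differentiable ℝ (perturbedFermiRadius (fun p : Fin 2 → ℝ => -K.eval p) μ) :=
  (contDiff_klFermiRadius B hA hDt hlo hhi (m := 1)).differentiable (by norm_num)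

/-! ## §2 The frame's Fermi point is Lipschitz in the angle -/

include B hA hlo hhi hDt in
/-- **Derivative of the frame's Fermi point**: `k_F′(θ) = u_K(θ)·dir(θ + π/2) + u_K′(θ)·dir θ`. -/
theorem hasDerivAt_klFermiPoint (θ : ℝ) :
    HasDerivAt (klFermiPoint μ K)
      (perturbedFermiRadius (fun p : Fin 2 → ℝ => -K.eval p) μ θ • dir (θ + π / 2) +
        deriv (perturbedFermiRadius (fun p : Fin 2 → ℝ => -K.eval p) μ) θ • dir θ) θ := by
  have hu := (differentiable_frameRadius B hA hlo hhi hDt θ).hasDerivAt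
  have h := hu.smul (PerturbedFermiCurve.hasDerivAt_dir θ)
  have heq : klFermiPoint μ K = fun ϑ => perturbedFermiRadius (fun p : Fin 2 → ℝ => -K.eval p) μ ϑ • dir ϑ := by
    funext ϑ; rfl
  rw [heq]
  exact h

include B hA hlo hhi hDt in
/-- The frame's Fermi point is differentiable in the angle. -/
theorem differentiable_klFermiPoint : Differentiable ℝ (klFermiPoint μ K) := fun θ =>
  (hasDerivAt_klFermiPoint B hA hlo hhi hDt θ).differentiableAt

include B hA hlo hhi hDt in
/-- **Speed of the frame's Fermi point**: `‖k_F′(θ)‖ ≤ u_K(θ) + |u_K′(θ)| ≤ π√2·(1 + (4 + 2A)/(Dt_min − 2A))`. -/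
theorem norm_deriv_klFermiPoint_le (θ : ℝ) :
    ‖deriv (klFermiPoint μ K) θ‖ ≤ π * Real.sqrt 2 * (1 + (4 + 2 * A) / (B.Dtmin - 2 * A)) := by
  rw [(hasDerivAt_klFermiPoint B hA hlo hhi hDt θ).deriv]
  set u := perturbedFermiRadius (fun p : Fin 2 → ℝ => -K.eval p) μ with hu_def
  have hupos : 0 < u θ := frameRadius_pos B hA hlo hhi θ
  have hule : u θ ≤ π * Real.sqrt 2 := frameRadius_le B hA hlo hhi θ
  have hd := abs_deriv_klFermiRadius_le B hA hDt hlo hhi θ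
  have hden : 0 < B.Dtmin - 2 * A := by linarith
  have hA0 : 0 ≤ A := by
    have := hA 0 0 (by norm_num)
    exact (norm_nonneg _).trans this
  calc ‖u θ • dir (θ + π / 2) + deriv u θ • dir θ‖
      ≤ ‖u θ • dir (θ + π / 2)‖ + ‖deriv u θ • dir θ‖ := norm_add_le _ _
    _ ≤ u θ + |deriv u θ| := by
        rw [norm_smul, norm_smul, Real.norm_eq_abs, Real.norm_eq_abs, abs_of_pos hupos]
        have h1 := norm_dir_le_one (θ + π / 2)
        have h2 := norm_dir_le_one θ
        have := abs_nonneg (deriv u θ)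
        nlinarith
    _ ≤ u θ + (4 + 2 * A) * u θ / (B.Dtmin - 2 * A) := by linarith
    _ = u θ * (1 + (4 + 2 * A) / (B.Dtmin - 2 * A)) := by ring
    _ ≤ π * Real.sqrt 2 * (1 + (4 + 2 * A) / (B.Dtmin - 2 * A)) := by
        apply mul_le_mul_of_nonneg_right hule
        positivity

include B hA hlo hhi hDt in
/-- **The frame's Fermi point is Lipschitz in the angle**: `‖k_F(θ) − k_F(θ′)‖ ≤ π√2·(1 + (4 + 2A)/(Dt_min − 2A))·|θ − θ′|` (sup norm). -/
theorem norm_klFermiPoint_sub_le (θ θ' : ℝ) :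
    ‖klFermiPoint μ K θ - klFermiPoint μ K θ'‖ ≤ π * Real.sqrt 2 * (1 + (4 + 2 * A) / (B.Dtmin - 2 * A)) * |θ - θ'| := by
  have h := Convex.norm_image_sub_le_of_norm_deriv_le (s := Set.univ) (f := klFermiPoint μ K)
    (fun x _ => differentiable_klFermiPoint B hA hlo hhi hDt x) (fun x _ => norm_deriv_klFermiPoint_le B hA hlo hhi hDt x)
    convex_univ (Set.mem_univ θ') (Set.mem_univ θ)
  rw [Real.norm_eq_abs] at h
  exact h

include B hA hlo hhi in
/-- The curve point as a complex number has modulus `u_K(θ)`: `‖momToComplex (k_F θ)‖ = u_K(θ)` (`≥ u_min`). -/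
theorem norm_momToComplex_klFermiPoint (θ : ℝ) :
    ‖momToComplex (klFermiPoint μ K θ)‖ = perturbedFermiRadius (fun p : Fin 2 → ℝ => -K.eval p) μ θ := by
  have hupos := frameRadius_pos B hA hlo hhi θ
  have hz : momToComplex (klFermiPoint μ K θ) =
      (perturbedFermiRadius (fun p : Fin 2 → ℝ => -K.eval p) μ θ : ℂ) * Complex.exp (θ * I) := by
    apply Complex.ext
    · simp [klFermiPoint, dir, Complex.exp_ofReal_mul_I_re]
    · simp [klFermiPoint, dir, Complex.exp_ofReal_mul_I_im]
  rw [hz, norm_mul, Complex.norm_exp_ofReal_mul_I, mul_one, Complex.norm_real, Real.norm_eq_abs, abs_of_pos hupos]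

include B hA hlo hhi in
/-- `u_min ≤ ‖momToComplex (k_F θ)‖`. -/
theorem umin_le_norm_momToComplex_klFermiPoint (θ : ℝ) : B.umin ≤ ‖momToComplex (klFermiPoint μ K θ)‖ := by
  rw [norm_momToComplex_klFermiPoint B hA hlo hhi]
  exact umin_le_frameRadius B hA hlo hhi θ

/-! ## §3 The frame read on its own curve is Lipschitz in the angle -/

include B hA hlo hhi hDt in
/-- **Derivative of `θ ↦ K(k_F(θ))`** along the curve (chain rule through `δ_K = −K`). -/
theorem hasDerivAt_frameOnCurve (θ : ℝ) :
    HasDerivAt (fun θ => K.eval (klFermiPoint μ K θ))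
      (-(fderiv ℝ (fun k : Fin 2 → ℝ => frameShift K (WithLp.toLp 2 k)) (klFermiPoint μ K θ)
          (deriv (klFermiPoint μ K) θ))) θ := by
  have hk := (differentiable_klFermiPoint B hA hlo hhi hDt θ).hasDerivAt
  have hg : HasFDerivAt (fun k : Fin 2 → ℝ => frameShift K (WithLp.toLp 2 k))
      (fderiv ℝ (fun k : Fin 2 → ℝ => frameShift K (WithLp.toLp 2 k)) (klFermiPoint μ K θ)) (klFermiPoint μ K θ) :=
    (differentiable_frameShift_toLp K _).hasFDerivAt
  have hcomp := HasFDerivAt.comp_hasDerivAt θ hg hk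
  have hneg := hcomp.neg
  have heq : (fun θ => K.eval (klFermiPoint μ K θ)) =
      fun θ => -((fun k : Fin 2 → ℝ => frameShift K (WithLp.toLp 2 k)) ∘ klFermiPoint μ K) θ := by
    funext θ; simp [frameShift]
  rw [heq]
  exact hneg

include B hA hlo hhi hDt in
/-- **Speed of the frame on its curve**: `|d/dθ K(k_F θ)| ≤ 2A·π√2·(1 + (4 + 2A)/(Dt_min − 2A))`. -/
theorem abs_deriv_frameOnCurve_le (θ : ℝ) :
    |deriv (fun θ => K.eval (klFermiPoint μ K θ)) θ| ≤ 2 * A * (π * Real.sqrt 2 * (1 + (4 + 2 * A) / (B.Dtmin - 2 * A))) := by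
  rw [(hasDerivAt_frameOnCurve B hA hlo hhi hDt θ).deriv, abs_neg]
  have h1 := norm_fderiv_frameShift_toLp_le hA (klFermiPoint μ K θ)
  have h2 := norm_deriv_klFermiPoint_le B hA hlo hhi hDt θ
  have hA0 : 0 ≤ A := by
    have := hA 0 0 (by norm_num)
    exact (norm_nonneg _).trans this
  calc |fderiv ℝ (fun k : Fin 2 → ℝ => frameShift K (WithLp.toLp 2 k)) (klFermiPoint μ K θ) (deriv (klFermiPoint μ K) θ)|
      = ‖fderiv ℝ (fun k : Fin 2 → ℝ => frameShift K (WithLp.toLp 2 k)) (klFermiPoint μ K θ) (deriv (klFermiPoint μ K) θ)‖ :=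
        (Real.norm_eq_abs _).symm
    _ ≤ ‖fderiv ℝ (fun k : Fin 2 → ℝ => frameShift K (WithLp.toLp 2 k)) (klFermiPoint μ K θ)‖ * ‖deriv (klFermiPoint μ K) θ‖ :=
        ContinuousLinearMap.le_opNorm _ _
    _ ≤ (2 * A) * (π * Real.sqrt 2 * (1 + (4 + 2 * A) / (B.Dtmin - 2 * A))) :=
        mul_le_mul h1 h2 (norm_nonneg _) (by positivity)

include B hA hlo hhi hDt in
/-- **The frame read on its own curve is Lipschitz in the angle**:
`|K(k_F θ) − K(k_F θ′)| ≤ 2A·π√2·(1 + (4 + 2A)/(Dt_min − 2A))·|θ − θ′|`. -/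
theorem abs_frameOnCurve_sub_le (θ θ' : ℝ) :
    |K.eval (klFermiPoint μ K θ) - K.eval (klFermiPoint μ K θ')| ≤
      2 * A * (π * Real.sqrt 2 * (1 + (4 + 2 * A) / (B.Dtmin - 2 * A))) * |θ - θ'| := by
  have hdiff : Differentiable ℝ (fun θ => K.eval (klFermiPoint μ K θ)) := fun θ =>
    (hasDerivAt_frameOnCurve B hA hlo hhi hDt θ).differentiableAt
  have h := Convex.norm_image_sub_le_of_norm_deriv_le (s := Set.univ) (f := fun θ => K.eval (klFermiPoint μ K θ))
    (fun x _ => hdiff x) (fun x _ => by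
      rw [Real.norm_eq_abs]; exact abs_deriv_frameOnCurve_le B hA hlo hhi hDt x)
    convex_univ (Set.mem_univ θ') (Set.mem_univ θ)
  rw [Real.norm_eq_abs, Real.norm_eq_abs] at h
  exact h

end Frame

/-! ## §4 In the KL regime, keyed by `FrameOK` on the covariance window `klWindowC` (the packaging of p4's `contDiff_klLocalPart_of_frameOK`) -/

/-- **Angular Lipschitz constants of the frame's curve for every ADMISSIBLE frame in the KL regime.**  For every renormalisation package
`R` (`Gfr ≥ 0`) there are `c₃, U₀ > 0`, a constant `Λ ≥ 0` and a radius `r₀ > 0` (all depending on `R` and the window only — in particular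
NOT on the volume, `β`, `U` or the frame) such that for `0 < c ≤ c₃`, `0 < U ≤ U₀`, `klBetaMin ≤ β ≤ e^{c/U²}`, `μ ∈ klWindowC` and every frame
`K` with `FrameOK R U (nScales β) ν K` (any `ν`): `θ ↦ klFermiPoint μ K θ` is `Λ`-Lipschitz (sup norm), `θ ↦ K(k_F θ)` is `Λ`-Lipschitz, and
`‖momToComplex (k_F θ)‖ ≥ r₀` — the three frame-side inputs of the off-lattice wiggle bound at `q = k_F θ`. -/
theorem frameCurve_lipschitz_of_frameOK (R : RenConsts) (hR : ∀ j, 0 ≤ R.Gfr j) :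
    ∃ c₃ : ℝ, 0 < c₃ ∧ ∃ U₀ : ℝ, 0 < U₀ ∧ ∃ Λ : ℝ, 0 ≤ Λ ∧ ∃ r₀ : ℝ, 0 < r₀ ∧
      ∀ c : ℝ, 0 < c → c ≤ c₃ → ∀ U : ℝ, 0 < U → U ≤ U₀ → ∀ β : ℝ, klBetaMin ≤ β → β ≤ Real.exp (c / U ^ 2) →
      ∀ μ ∈ klWindowC, ∀ (ν : ℝ) (K : TrigPolyC4v), FrameOK R U (nScales β) ν K →
        (∀ θ θ' : ℝ, ‖klFermiPoint μ K θ - klFermiPoint μ K θ'‖ ≤ Λ * |θ - θ'|) ∧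
        (∀ θ θ' : ℝ, |K.eval (klFermiPoint μ K θ) - K.eval (klFermiPoint μ K θ')| ≤ Λ * |θ - θ'|) ∧
        (∀ θ : ℝ, r₀ ≤ ‖momToComplex (klFermiPoint μ K θ)‖) := by
  have ha : (-4 : ℝ) < -1.1 := by norm_num
  have hab : (-1.1 : ℝ) ≤ -0.1 := by norm_num
  have hb : (-0.1 : ℝ) < 0 := by norm_num
  set B := bandBounds ha hab hb with hBdef
  have hDt := B.Dtmin_pos
  set κ : ℝ := min B.Dtmin (1 / 5) with hκdef
  have hκ : 0 < κ := lt_min hDt (by norm_num)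
  obtain ⟨c₃, hc₃, U₀, hU₀, hthr⟩ := frame_thresholds hR hκ
  -- the volume-free constants
  set Λ : ℝ := π * Real.sqrt 2 * (1 + (4 + B.Dtmin) / (B.Dtmin / 2)) with hΛdef
  have hΛ0 : 0 ≤ Λ := by positivity
  refine ⟨c₃, hc₃, U₀, hU₀, Λ, hΛ0, B.umin, B.umin_pos, ?_⟩
  intro c hc hcle U hU hUle β hβmin hβc μ hμ ν K hK
  have hAf : ∀ p : Momentum, ∀ j ≤ 2, ‖iteratedFDeriv ℝ j (frameShift K) p‖ ≤
      2 * R.Gfr 0 * |U| + 2 * R.Gfr 1 * U ^ 2 + R.Gfr 2 * (c / Real.log 4) := fun p j hj =>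
    norm_iteratedFDeriv_frameShift_le_of_frameOK_regime hR hc.le hβmin hβc hK p hj
  set A := 2 * R.Gfr 0 * |U| + 2 * R.Gfr 1 * U ^ 2 + R.Gfr 2 * (c / Real.log 4) with hAdef
  have h4A : 4 * A ≤ κ := hthr c U hc.le hcle hU hUle
  have hA0 : 0 ≤ A := le_trans (norm_nonneg _) (hAf 0 0 (by norm_num))
  have hκDt : κ ≤ B.Dtmin := min_le_left _ _
  have hκ5 : κ ≤ 1 / 5 := min_le_right _ _
  have hADt : 2 * A < B.Dtmin := by linarith
  have hA20 : A ≤ 1 / 20 := by linarith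
  obtain ⟨hlo, hhi⟩ := PerturbedFermiCurve.klWindowC_margin hμ hA20
  -- the `A`-dependent constant is below `Λ`
  have hden : B.Dtmin / 2 ≤ B.Dtmin - 2 * A := by linarith
  have hfrac : (4 + 2 * A) / (B.Dtmin - 2 * A) ≤ (4 + B.Dtmin) / (B.Dtmin / 2) := by
    rw [div_le_div_iff₀ (by linarith) (by linarith)]
    nlinarith
  have hΛ1 : π * Real.sqrt 2 * (1 + (4 + 2 * A) / (B.Dtmin - 2 * A)) ≤ Λ := by
    rw [hΛdef]
    apply mul_le_mul_of_nonneg_left _ (by positivity)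
    linarith
  have hΛ2 : 2 * A * (π * Real.sqrt 2 * (1 + (4 + 2 * A) / (B.Dtmin - 2 * A))) ≤ Λ := by
    have h2A : 2 * A ≤ 1 := by linarith
    have hpos : 0 ≤ π * Real.sqrt 2 * (1 + (4 + 2 * A) / (B.Dtmin - 2 * A)) := by
      have : 0 ≤ (4 + 2 * A) / (B.Dtmin - 2 * A) := div_nonneg (by linarith) (by linarith)
      positivity
    calc 2 * A * (π * Real.sqrt 2 * (1 + (4 + 2 * A) / (B.Dtmin - 2 * A)))
        ≤ 1 * (π * Real.sqrt 2 * (1 + (4 + 2 * A) / (B.Dtmin - 2 * A))) := mul_le_mul_of_nonneg_right h2A hpos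
      _ ≤ Λ := by rw [one_mul]; exact hΛ1
  refine ⟨fun θ θ' => ?_, fun θ θ' => ?_, fun θ => ?_⟩
  · exact (norm_klFermiPoint_sub_le B hAf hlo hhi hADt θ θ').trans (mul_le_mul_of_nonneg_right hΛ1 (abs_nonneg _))
  · exact (abs_frameOnCurve_sub_le B hAf hlo hhi hADt θ θ').trans (mul_le_mul_of_nonneg_right hΛ2 (abs_nonneg _))
  · exact umin_le_norm_momToComplex_klFermiPoint B hAf hlo hhi θ

end Summit.HubbardSuperconductivity.HubbardSuperconductivity.Theorems.KLRegimeSplit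

end
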